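import Literature.NumberTheory.Automorphic.Liu2021.LemD1AsPrintedIndexedNonVacuityLevelCarrier
import HarnessLib

/-!
# [Liu2021, App. D Lemma D.1 (1) ∧ (3)] AS PRINTED with the `μ`-conjunct ALONE separating — every SPLIT place, every `N ≥ 3`:
# `det : U(V)(F_v) → E_v¹` is ONTO (every place), and the DET CARRIER `Ψ = ν_w ∘ det_w` is trivial on the centre

Reproduction ∕ bookkeeping (Literature, THEOREMS ONLY: no definition, no record, no named fact, no `sorry`; nothing is
asserted about Liu's oscillator representations or about the tree's constructed local Weil carriers).

Sequel of `LemD1AsPrintedIndexedNonVacuityLevelCarrier.lean`, whose «What this does NOT give» opens with «a two-member model in which (3)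
holds and ONLY the μ-slot separates (two non-isomorphic carriers with the SAME central character: `Λ` restricted to the centre is `χ_Λ`,
which differs from `1` in general)».  THIS FILE builds that model at every SPLIT place `v` of ANY quadratic extension `E/F` of number fields,
for every rank `N ≥ 3`, from two elementary facts about the place model `U(V)(F_v) = S.U ≤ GL_N(E_v)`, `E_v = Π_{w∣v} E_w`:

* §1–§2 **`det : U(V)(F_v) → E_v¹` is SURJECTIVE** (`exists_mem_U_det_eq`; EVERY finite place, EVERY `N ≥ 2`): for `z ∈ E_v¹` (`z · (c ⊗ 1) z = 1`)
  the DILATION `R = 1 − ((1 − z)/⟨x,x⟩) · x · x†` (`x† = ((c ⊗ 1) x)ᵀ (J ⊗ 1)`) along the image of an anisotropic vector `x` of the GLOBAL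
  hermitian space `(Eᴺ, J)` (`⟨x, x⟩ ∈ Eˣ`, a unit of `E_v`) lies in `U(V)(F_v)`, with inverse the dilation of ratio `(c ⊗ 1) z` and `det R = z`
  (matrix determinant lemma) — pure algebra over the commutative ring `E_v` with the involution `c ⊗ 1` (§1, `exists_dilation`: the scalar
  identity `(1 − z) + (1 − z̄) = (1 − z)(1 − z̄) ⟺ z z̄ = 1`).  `…LevelCarrier.exists_mem_U_det_eq_neg_one` was the case `z = −1`; the corollary
  `exists_mem_U_det_eq_algebraMap` serves the global norm-one elements `a ∈ E`, `a · c(a) = 1`.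
* §3 at a SPLIT place (`w ∣ v` with `c • w ≠ w`): a GLOBAL norm-one element of `w`-order one, `a = b / c(b)` with `v_w(b) = exp(−1)`,
  `v_{c•w}(b) = 1` (Chinese remainder theorem at the two primes `w ≠ c • w`; `v_w(c b) = v_{c • w}(b)`, tree `valuation_algEquiv_smul`)
  (`exists_mul_conj_eq_one_valuation_eq_of_split`); and **the DET CARRIER character** `Ψ(g) = ν_w(det(g)_w) = ζ_N^{ord_w det(g)_w}` of `U(V)(F_v)`
  (`ν_w` the unramified character of `E_wˣ` of order dividing `N`, as in `…AtPlace` §2): `Ψ ∘ S.scalar = 1` (`det(z · 1_N) = z^N`, `ν_w^N = 1`),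
  `Ψ = 1` on the open neighbourhood `{g : v_w(det(g)_w) = 1}` of `1`, and `Ψ(g₀) = ζ_N^{−1} ≠ 1` at the dilation `g₀` of ratio `ι(a)`
  (`exists_det_carrier_character_of_split`).  So `U(V)(F_v)` has two characters, `1` and `Ψ`, with the SAME restriction to the centre `E_v¹`.
* §4 **`exists_lemD1IndexedFamily_item1_and_lemD1_3_mu_of_split`** (every split place, every `N ≥ 3`, every `μ ∈ MuSet S`, every representative
  `e`): the two-member collection with labels `(μ, e, 1)`, `(μ', e, 1)` — `μ'` the level twist of `…LevelTwist` (`μ'(ε) = −μ(ε)`), the SAME `ε`,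
  the SAME Step-3 character `χ = 1` — and carriers the trivial line and the line of `Ψ` satisfies [Lem. D.1, first sentence + (1)] AS PRINTED
  member by member AND [Lem. D.1 (3)] AS PRINTED for all four pairs; of the three printed conjuncts exactly «`μ' = μ`» fails, and the `ω`'s
  are non-isomorphic with EQUAL central characters.  Hypothesis-free consequences (the Step-2 index set contains `1` at a split place,
  `…AtPlace.one_mem_muSet_of_split`): **`not_forall_mu_eq_of_sameClass_of_chi_eq_of_split`** (the records do not force «same `ε`-class ∧ same
  `χ` ⟹ same `μ`») and **`not_forall_areIsomorphicRep_of_chi_eq_of_split`** (nor «same `χ` ⟹ isomorphic `ω`'s»).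
* §5 the CM rows (`L` CM, `F = L⁺`, member `0` = the rows' own `μ_v = localMu L (toHeckeCharacter L ψ) v`) at a split place of `L⁺`:
  `exists_lemD1IndexedFamily_item1_and_lemD1_3_localMu_mu_of_split`, `not_forall_mu_eq_of_sameClass_of_chi_eq_of_isCMField_of_split`,
  `not_forall_areIsomorphicRep_of_chi_eq_of_isCMField_of_split`.

What this does NOT give: the `μ`-alone model at a NON-SPLIT place `w = c • w` (there `E_w¹` is compact, every finite-dimensional carrier is a
sum of characters `θ ∘ det`, and a character of `E_w¹` trivial on the `N`-th powers but not on `E_w¹` exists iff `(E_w¹ : (E_w¹)^N) > 1` — for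
`N = 3` and `w ∤ 3` inert: iff `q_v ≡ 2 (mod 3)` —, a genuinely place-dependent condition); anything about the rows' OWN carriers `𝓢.omegaLoc v`;
Lem. D.1 itself.  HC_CM is NOT proved.

Cell pub-hodgecm2 (COR-CM), audit class of the END rows `hD1''` ∕ `hD3`; seat prover-pub-hodgecm2-b10.

References: [Liu2021] Y. Liu, *Fourier–Jacobi cycles and arithmetic relative trace formula*, Camb. J. Math. 9 (2021) =
arXiv:2102.11518, App. D §D.1 (the hermitian space `V`, l. 5213; Steps 1–3, l. 5217–5221), Lemma D.1 (1) (l. 5229), (3) (l. 5233),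
Def. 4.11 (l. 2086); [Mok2014] C. P. Mok, Mem. AMS 235 (2015), §1 Notation p. 5 (`U(J)(F_v) ≤ GL_N(E ⊗ F_v)`; for `v` split
`U(N)(F_v) ≅ GL_N(F_v)`); [CasselsFrohlichANT1967] Ch. II §10 (`L ⊗_K K_v = Π_{w∣v} L_w`), Ch. VII §1.1 (`|a|_{σ w} = |σ⁻¹ a|_w`);
[NeukirchANT1999] Ch. I §3 (Chinese remainder theorem in Dedekind rings, (3.6)), Ch. II §3 (valuations, uniformisers).
-/

noncomputable section

open scoped Matrix MatrixGroups
open NumberField IsDedekindDomain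
open Literature.RepresentationTheory
open Literature.RepresentationTheory.Liu2021 (OscillatorStandingData)
open Literature.RepresentationTheory.CentralCharacterQuotient (augmentation quotRep quotRep_mk)
open Literature.NumberTheory.GaloisRepresentations (HeckeCharacter)

namespace Literature.NumberTheory.Automorphic.Liu2021.LemD1IndexedNonVacuityDetCarrier

open UnitaryGroup

/-! ## §1 Dilations of a hermitian space along an anisotropic vector (algebra over a commutative ring with involution) -/

section Algebra

variable {F E : Type} [Field F] [Field E] [Algebra F E] (c : E ≃ₐ[F] E) {N : ℕ} (J : Matrix (Fin N) (Fin N) E)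

/-- hermitian symmetry entrywise: `c (J i j) = J j i` (copy of the siblings' private lemma). [folklore] -/
private theorem apply_entry_of_hermitian (hJh : (J.map c)ᵀ = J) (i j : Fin N) : c (J i j) = J j i := by
  have h := congrArg (fun M : Matrix (Fin N) (Fin N) E => M j i) hJh
  simpa only [Matrix.transpose_apply, Matrix.map_apply] using h

/-- **an anisotropic vector** of a non-degenerate hermitian space `(Eᴺ, J)`, `N ≥ 1` (a diagonal entry `J_ii ≠ 0`, or
`x = e_i + J_ij⁻¹ e_j` with `⟨x, x⟩ = 2`); copy of the siblings' private lemma. [folklore] -/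
private theorem exists_form_self_ne_zero [CharZero E] (hN : 1 ≤ N) (hJh : (J.map c)ᵀ = J) (hJdet : J.det ≠ 0) :
    ∃ x : Fin N → E, ((fun i => c (x i)) ᵥ* J) ⬝ᵥ x ≠ 0 := by
  classical
  have hherm := apply_entry_of_hermitian c J hJh
  by_cases hdiag : ∃ i, J i i ≠ 0
  · obtain ⟨i, hi⟩ := hdiag
    refine ⟨Pi.single i 1, ?_⟩
    have hc1 : (fun k => c ((Pi.single i (1 : E) : Fin N → E) k)) = Pi.single i 1 := by
      funext k
      by_cases hk : k = i
      · subst hk; simp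
      · simp [Pi.single_eq_of_ne hk]
    rw [hc1, Matrix.single_one_vecMul, dotProduct_single, mul_one]
    exact hi
  · push Not at hdiag
    have hJ0 : ∃ i j, J i j ≠ 0 := by
      by_contra h
      push Not at h
      apply hJdet
      have hJ : J = 0 := Matrix.ext fun i j => h i j
      haveI : Nonempty (Fin N) := ⟨⟨0, by omega⟩⟩
      rw [hJ, Matrix.det_zero]
    obtain ⟨i, j, hij⟩ := hJ0
    have hne : j ≠ i := by
      rintro rfl
      exact hij (hdiag j)
    set s : E := (J i j)⁻¹ with hs
    refine ⟨Pi.single i 1 + Pi.single j s, ?_⟩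
    have hc : (fun k => c ((Pi.single i (1 : E) + Pi.single j s : Fin N → E) k)) = Pi.single i 1 + Pi.single j (c s) := by
      funext k
      simp only [Pi.add_apply, map_add]
      by_cases hki : k = i
      · subst hki
        simp [Pi.single_eq_of_ne hne.symm]
      · by_cases hkj : k = j
        · subst hkj
          simp [Pi.single_eq_of_ne hki]
        · simp [Pi.single_eq_of_ne hki, Pi.single_eq_of_ne hkj]
    rw [hc, Matrix.add_vecMul, add_dotProduct, dotProduct_add, dotProduct_add, Matrix.single_one_vecMul,
      Matrix.single_vecMul, dotProduct_single, dotProduct_single, smul_dotProduct, smul_dotProduct,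
      dotProduct_single, dotProduct_single]
    simp only [Matrix.row_apply, smul_eq_mul, mul_one]
    rw [hdiag i, hdiag j, ← hherm i j, ← map_mul, hs, inv_mul_cancel₀ hij, mul_inv_cancel₀ hij, map_one]
    norm_num

/-- **the dilation with ratio `a`, `a · σ(a) = 1`, along a vector `x` whose length `q = ⟨x, x⟩ = x† x` is a UNIT** — over ANY
commutative ring `A` with an involution `σ` and a `σ`-hermitian `J`: the matrices `R = 1 − ((1 − a) q⁻¹) · x · x†`,
`R' = 1 − ((1 − σ a) q⁻¹) · x · x†` (`x† = σ(x)ᵀ J`) satisfy `(σ R)ᵀ J R = J`, `R R' = R' R = 1`, `det R = a` (`R` acts by `a` on the line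
of `x` and by `1` on its `J`-orthogonal; the key scalar identity is `s + s' = s s' q` for `s = (1 − a) q⁻¹`, `s' = (1 − σ a) q⁻¹`, i.e.
`(1 − a) + (1 − σ a) = (1 − a)(1 − σ a)`, i.e. `a σ(a) = 1`). [folklore] -/
private theorem exists_dilation {A : Type} [CommRing A] (σ : A →+* A) (hσ : ∀ y, σ (σ y) = y) {N : ℕ}
    (J : Matrix (Fin N) (Fin N) A) (hJh : (J.map σ)ᵀ = J) (x : Fin N → A) (hq : IsUnit (((fun i => σ (x i)) ᵥ* J) ⬝ᵥ x))
    (a : A) (ha : a * σ a = 1) :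
    ∃ R R' : Matrix (Fin N) (Fin N) A, (R.map σ)ᵀ * J * R = J ∧ R * R' = 1 ∧ R' * R = 1 ∧ R.det = a := by
  classical
  have hherm : ∀ i j, σ (J i j) = J j i := fun i j => by
    have h := congrArg (fun M : Matrix (Fin N) (Fin N) A => M j i) hJh
    simpa only [Matrix.transpose_apply, Matrix.map_apply] using h
  set xc : Fin N → A := fun i => σ (x i) with hxc
  set w : Fin N → A := xc ᵥ* J with hw
  set q : A := w ⬝ᵥ x with hqdef
  obtain ⟨qu, hqu⟩ := hq
  set qi : A := ((qu⁻¹ : Aˣ) : A) with hqi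
  have hqqi : q * qi = 1 := by rw [hqi, ← hqu, Units.mul_inv]
  set s : A := (1 - a) * qi with hs
  set s' : A := (1 - σ a) * qi with hs'
  have hcw : (fun j => σ (w j)) = J *ᵥ x := by
    funext j
    rw [hw, Matrix.vecMul, Matrix.mulVec, dotProduct, dotProduct, map_sum]
    refine Finset.sum_congr rfl fun i _ => ?_
    rw [map_mul, hxc, hσ, hherm, mul_comm]
  have hcq : σ q = q := by
    calc σ q = ∑ i, σ (w i) * σ (x i) := by rw [hqdef, dotProduct, map_sum]; simp_rw [map_mul]
      _ = (J *ᵥ x) ⬝ᵥ xc := by rw [← hcw]; rfl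
      _ = q := by rw [dotProduct_comm, Matrix.dotProduct_mulVec, ← hw, hqdef]
  have hcqi : σ qi = qi := by
    have h1 : σ qi * q = 1 := by rw [← hcq, ← map_mul, mul_comm, hqqi, map_one]
    calc σ qi = σ qi * (q * qi) := by rw [hqqi, mul_one]
      _ = qi := by rw [← mul_assoc, h1, one_mul]
  have hcs : σ s = s' := by rw [hs, hs', map_mul, map_sub, map_one, hcqi]
  have hsq : s * q = 1 - a := by rw [hs, mul_assoc, mul_comm qi, hqqi, mul_one]
  have hs'q : s' * q = 1 - σ a := by rw [hs', mul_assoc, mul_comm qi, hqqi, mul_one]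
  -- the key scalar identity `s + s' = s s' q`
  have hkey : s + s' - s * s' * q = 0 := by
    have h1 : (s + s' - s * s' * q) * q = 0 := by
      have : (s + s' - s * s' * q) * q = s * q + s' * q - (s * q) * (s' * q) := by ring
      rw [this, hsq, hs'q]
      linear_combination (-1 : A) * ha
    calc s + s' - s * s' * q = (s + s' - s * s' * q) * (q * qi) := by rw [hqqi, mul_one]
      _ = 0 := by rw [← mul_assoc, h1, zero_mul]
  refine ⟨1 - Matrix.vecMulVec (s • x) w, 1 - Matrix.vecMulVec (s' • x) w, ?_, ?_, ?_, ?_⟩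
  · -- isometry
    have hmapc : (1 - Matrix.vecMulVec (s • x) w).map σ = 1 - Matrix.vecMulVec (s' • xc) (J *ᵥ x) := by
      ext i j
      simp only [Matrix.map_apply, Matrix.sub_apply, Matrix.one_apply, Matrix.vecMulVec_apply, Pi.smul_apply,
        smul_eq_mul, map_sub, map_mul, hcs, ← hcw, hxc]
      split_ifs <;> simp
    rw [hmapc, Matrix.transpose_sub, Matrix.transpose_one, Matrix.transpose_vecMulVec]
    rw [Matrix.sub_mul, Matrix.one_mul, Matrix.mul_sub, Matrix.mul_one, Matrix.sub_mul,
      Matrix.vecMulVec_mul, Matrix.smul_vecMul, ← hw, Matrix.mul_vecMulVec, Matrix.mulVec_smul,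
      Matrix.vecMulVec_mul_vecMulVec]
    have hinner : (s' • w) ⬝ᵥ (s • x) = s' * (s * q) := by
      rw [smul_dotProduct, dotProduct_smul, smul_eq_mul, smul_eq_mul, ← hqdef]
    rw [hinner]
    ext i j
    simp only [Matrix.sub_apply, Matrix.vecMulVec_apply, Pi.smul_apply, smul_eq_mul]
    linear_combination (-(J *ᵥ x) i * w j) * hkey
  · -- `R R' = 1`
    rw [Matrix.sub_mul, Matrix.one_mul, Matrix.mul_sub, Matrix.mul_one, Matrix.vecMulVec_mul_vecMulVec]
    have hinner : w ⬝ᵥ (s' • x) = s' * q := by rw [dotProduct_smul, smul_eq_mul, ← hqdef]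
    rw [hinner]
    ext i j
    simp only [Matrix.sub_apply, Matrix.one_apply, Matrix.vecMulVec_apply, Pi.smul_apply, smul_eq_mul]
    linear_combination (-(x i) * w j) * hkey
  · -- `R' R = 1`
    rw [Matrix.sub_mul, Matrix.one_mul, Matrix.mul_sub, Matrix.mul_one, Matrix.vecMulVec_mul_vecMulVec]
    have hinner : w ⬝ᵥ (s • x) = s * q := by rw [dotProduct_smul, smul_eq_mul, ← hqdef]
    rw [hinner]
    ext i j
    simp only [Matrix.sub_apply, Matrix.one_apply, Matrix.vecMulVec_apply, Pi.smul_apply, smul_eq_mul]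
    linear_combination (-(x i) * w j) * hkey
  · -- determinant (matrix determinant lemma)
    have hre : (1 : Matrix (Fin N) (Fin N) A) - Matrix.vecMulVec (s • x) w = 1 + Matrix.vecMulVec ((-s) • x) w := by
      rw [Matrix.smul_vecMulVec, Matrix.smul_vecMulVec, neg_smul, sub_eq_add_neg]
    rw [hre, Matrix.vecMulVec_eq (Fin 1), Matrix.det_one_add_replicateCol_mul_replicateRow, dotProduct_smul, smul_eq_mul,
      ← hqdef, neg_mul, hsq]
    ring

end Algebra

/-! ## §2 `det : U(V)(F_v) → E_v¹` is SURJECTIVE — every `N ≥ 2`, every finite place `v` -/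

section PlaceModel

variable {F : Type} (E : Type) [Field F] [NumberField F] [Field E] [NumberField E] [Algebra F E]
  [Algebra.IsQuadraticExtension F E] (v : HeightOneSpectrum (𝓞 F)) (c : E ≃ₐ[F] E)
  {δ : E} (hcδ : c δ = -δ) (hδ : δ ≠ 0)
  (N : ℕ) (J : Matrix (Fin N) (Fin N) E) (hN : 2 ≤ N) (hJh : (J.map c)ᵀ = J) (hJdet : J.det ≠ 0)

include v hcδ hδ in
/-- `c` is an involution of `E` (read off in `E_v`, where `(c ⊗ 1)² = 1` is the tree's `conjLocal_conjLocal_apply`); copy of the siblings'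
private lemma. [cite: CasselsFrohlichANT1967, Ch. II §10] -/
private theorem conj_conj_apply (x : E) : c (c x) = x :=
  (algebraMap E (LocalRing E v)).injective (by
    rw [← conjLocal_algebraMap, ← conjLocal_algebraMap, LemD1OfPlace.conjLocal_conjLocal_apply E v c hcδ hδ])

include hcδ in
/-- **`det : U(V)(F_v) → E_v¹` is ONTO** for the place model of [Liu2021, App. D §D.1] at ANY finite place `v` and ANY `N ≥ 2`: every
norm-one element `z ∈ E_v¹ = S.normOne` (`z · (c ⊗ 1) z = 1`) is the determinant of an element of the unitary group `U(V)(F_v) = S.U` —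
the dilation of §1 with ratio `z` along (the image in `E_vᴺ` of) an anisotropic vector of the global hermitian space `(Eᴺ, J)`, whose length
`⟨x, x⟩ ∈ Eˣ` is a unit of `E_v`.  (`…LevelCarrier.exists_mem_U_det_eq_neg_one` is `z = −1`.) [cite: Liu2021, App. D §D.1 (l. 5213)]
[cite: Mok2014, §1 Notation p. 5] -/
theorem exists_mem_U_det_eq (z : (LemD1OfPlace.standingData E v c N J hcδ hδ hN hJh hJdet).normOne) :
    ∃ g : (LemD1OfPlace.standingData E v c N J hcδ hδ hN hJh hJdet).U,
      Matrix.GeneralLinearGroup.det (g : GL (Fin N) (LocalRing E v)) = (z : (LocalRing E v)ˣ) := by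
  let φ := algebraMap E (LocalRing E v)
  obtain ⟨x, hq⟩ := exists_form_self_ne_zero c J (by omega) hJh hJdet
  have hσσ : ∀ y, conjLocal E c v (conjLocal E c v y) = y := LemD1OfPlace.conjLocal_conjLocal_apply E v c hcδ hδ
  have hcφ : (conjLocal E c v) ∘ φ = φ ∘ c := funext fun y => conjLocal_algebraMap c v y
  have hJv : ((J.map φ).map (conjLocal E c v))ᵀ = J.map φ := by
    rw [Matrix.map_map, hcφ, ← Matrix.map_map, ← Matrix.transpose_map, hJh]
  set xv : Fin N → LocalRing E v := fun i => φ (x i) with hxv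
  have hqv : ((fun i => conjLocal E c v (xv i)) ᵥ* J.map φ) ⬝ᵥ xv = φ (((fun i => c (x i)) ᵥ* J) ⬝ᵥ x) := by
    have h1 : (fun i => conjLocal E c v (xv i)) = φ ∘ (fun i => c (x i)) := funext fun i => conjLocal_algebraMap c v (x i)
    have h2 : xv = φ ∘ x := rfl
    rw [h1, h2, RingHom.map_dotProduct]
    congr 1
    funext j
    exact (RingHom.map_vecMul φ J (fun i => c (x i)) j).symm
  have hunit : IsUnit (((fun i => conjLocal E c v (xv i)) ᵥ* J.map φ) ⬝ᵥ xv) := by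
    rw [hqv]
    exact (IsUnit.mk0 _ hq).map φ
  obtain ⟨R, R', hRJ, hRR', hR'R, hRdet⟩ := exists_dilation (conjLocal E c v) hσσ (J.map φ) hJv xv hunit
    ((z : (LocalRing E v)ˣ) : LocalRing E v) (LemD1OfPlace.mul_conjLocal_eq_one E v c N J hcδ hδ hN hJh hJdet z)
  let Rv : GL (Fin N) (LocalRing E v) := ⟨R, R', hRR', hR'R⟩
  have hmem : Rv ∈ (LemD1OfPlace.standingData E v c N J hcδ hδ hN hJh hJdet).U := by
    rw [OscillatorStandingData.mem_U_iff, LemD1OfPlace.standingData_gram, LemD1OfPlace.localGram_eq]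
    have hconj : ⇑(LemD1OfPlace.standingData E v c N J hcδ hδ hN hJh hJdet).conj = conjLocal E c v :=
      funext fun y => LemD1OfPlace.standingData_conj_apply E v c N J hcδ hδ hN hJh hJdet y
    change ((R.map (LemD1OfPlace.standingData E v c N J hcδ hδ hN hJh hJdet).conj)ᵀ * J.map φ * R = J.map φ)
    rw [hconj]
    exact hRJ
  refine ⟨⟨Rv, hmem⟩, Units.ext ?_⟩
  rw [Matrix.GeneralLinearGroup.val_det_apply]
  change R.det = _
  exact hRdet

include hcδ in
/-- **Corollary: the GLOBAL norm-one elements** — for `a ∈ E` with `a · c(a) = 1`, some `g ∈ U(V)(F_v)` has `det g = ι(a)` (`ι : E → E_v`).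
[cite: Liu2021, App. D §D.1 (l. 5213)] -/
theorem exists_mem_U_det_eq_algebraMap (a : E) (ha : a * c a = 1) :
    ∃ g : (LemD1OfPlace.standingData E v c N J hcδ hδ hN hJh hJdet).U,
      ((Matrix.GeneralLinearGroup.det (g : GL (Fin N) (LocalRing E v)) : (LocalRing E v)ˣ) : LocalRing E v) =
        algebraMap E (LocalRing E v) a := by
  have hu : IsUnit (algebraMap E (LocalRing E v) a) :=
    IsUnit.of_mul_eq_one (algebraMap E (LocalRing E v) (c a)) (by rw [← map_mul, ha, map_one])
  have hz : hu.unit ∈ (LemD1OfPlace.standingData E v c N J hcδ hδ hN hJh hJdet).normOne := by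
    rw [OscillatorStandingData.mem_normOne_iff', LemD1OfPlace.standingData_conj_apply, IsUnit.unit_spec, conjLocal_algebraMap,
      ← map_mul, ha, map_one]
  obtain ⟨g, hg⟩ := exists_mem_U_det_eq E v c hcδ hδ N J hN hJh hJdet ⟨_, hz⟩
  exact ⟨g, by rw [hg]; exact hu.unit_spec⟩

/-! ## §3 SPLIT places: the DET CARRIER `Ψ = ν_w ∘ det_w` — trivial on the centre, non-trivial on `U(V)(F_v)` -/

include v hcδ hδ in
/-- `c * c = 1`. [folklore] -/
private theorem conj_mul_conj : c * c = 1 :=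
  AlgEquiv.ext fun x => by rw [AlgEquiv.mul_apply, conj_conj_apply E v c hcδ hδ]; rfl

include hcδ hδ in
/-- **at a SPLIT place (`c • w ≠ w`) there is a GLOBAL norm-one element of `w`-order `1`**: `a ∈ E` with `a · c(a) = 1` and
`v_w(a) = exp(−1)` — namely `a = b / c(b)` for `b ∈ 𝓞 E` with `v_w(b) = exp(−1)` and `v_{c • w}(b) = 1` (Chinese remainder theorem for the
two distinct primes `w`, `c • w`; `v_w(c b) = v_{c • w}(b)`). [cite: CasselsFrohlichANT1967, Ch. II §10] -/
theorem exists_mul_conj_eq_one_valuation_eq_of_split (w : PlacesOver E v) (hw : c • w.1 ≠ w.1) :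
    ∃ a : E, a * c a = 1 ∧ w.1.valuation E a = WithZero.exp (-1 : ℤ) := by
  classical
  obtain ⟨π, hπ⟩ := w.1.intValuation_exists_uniformizer
  -- Chinese remainder theorem at the two primes `w`, `c • w`
  let P : HeightOneSpectrum (𝓞 E) → Ideal (𝓞 E) := fun u => u.asIdeal
  let e : HeightOneSpectrum (𝓞 E) → ℕ := fun u => if u = w.1 then 2 else 1
  let s : Finset (HeightOneSpectrum (𝓞 E)) := {w.1, c • w.1}
  have hprime : ∀ u ∈ s, Prime (P u) := fun u _ => u.prime
  have hcop : ∀ᵉ (i ∈ s) (j ∈ s), i ≠ j → P i ≠ P j := fun i _ j _ hij h => hij (HeightOneSpectrum.ext h)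
  obtain ⟨y, hy⟩ := IsDedekindDomain.exists_forall_sub_mem_ideal P e hprime hcop
    (fun i => if (i : HeightOneSpectrum (𝓞 E)) = w.1 then π else 1)
  have h1 : y - π ∈ w.1.asIdeal ^ 2 := by
    have := hy w.1 (by simp [s])
    simpa [P, e] using this
  have h2 : y - 1 ∈ (c • w.1).asIdeal := by
    have := hy (c • w.1) (by simp [s])
    simpa [P, e, hw] using this
  -- `v_w(y) = exp(−1)`, `v_{c • w}(y) = 1`
  have hyw : w.1.intValuation y = WithZero.exp (-1 : ℤ) := by
    rw [← hπ]
    refine Valuation.map_eq_of_sub_lt _ ?_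
    rw [hπ]
    exact ((w.1.intValuation_le_pow_iff_mem (y - π) 2).2 h1).trans_lt (WithZero.exp_lt_exp.2 (by norm_num))
  have hycw : (c • w.1).intValuation y = 1 := by
    rw [← (c • w.1).intValuation.map_one]
    refine Valuation.map_eq_of_sub_lt _ ?_
    rw [Valuation.map_one]
    exact ((c • w.1).intValuation_lt_one_iff_mem (y - 1)).2 h2
  set b : E := algebraMap (𝓞 E) E y with hb
  have hbw : w.1.valuation E b = WithZero.exp (-1 : ℤ) := by rw [hb, HeightOneSpectrum.valuation_of_algebraMap, hyw]
  have hbcw : (c • w.1).valuation E b = 1 := by rw [hb, HeightOneSpectrum.valuation_of_algebraMap, hycw]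
  have hb0 : b ≠ 0 := fun h => by
    rw [h, map_zero] at hbw
    exact WithZero.exp_ne_zero hbw.symm
  have hcb0 : c b ≠ 0 := fun h => hb0 (EmbeddingLike.map_eq_zero_iff.1 h)
  -- `v_w(c b) = v_{c • w}(b) = 1`
  have hcbw : w.1.valuation E (c b) = 1 := by
    have h := HeightOneSpectrum.valuation_algEquiv_smul (F := F) c (c • w.1) b
    rw [smul_smul, conj_mul_conj E v c hcδ hδ, one_smul] at h
    rw [h, hbcw]
  refine ⟨b * (c b)⁻¹, ?_, ?_⟩
  · rw [map_mul, map_inv₀, conj_conj_apply E v c hcδ hδ]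
    field_simp
  · rw [map_mul, map_inv₀, hbw, hcbw, inv_one, mul_one]

omit [Algebra F E] [Algebra.IsQuadraticExtension F E] in
/-- **the unramified character `ν_w = ζ_N^{ord_w}` of `E_wˣ` of order dividing `N`** (`ζ_N = e^{2πi/N}`, `N ≥ 2`): unitary, continuous,
trivial on the units of valuation `1`, `ν^N = 1`, and `ν(x) ≠ 1` whenever `v_w(x) = exp(−1)`.  Copy (with the last clause universal) of the
private lemma of `LemD1AsPrintedIndexedNonVacuityAtPlace.lean` §2. [folklore] -/
private theorem exists_unramified_character (w : HeightOneSpectrum (𝓞 E)) {N : ℕ} (hN : 2 ≤ N) :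
    ∃ ν : (w.adicCompletion E)ˣ →* ℂˣ,
      (∀ x, ‖((ν x : ℂˣ) : ℂ)‖ = 1) ∧
      (∀ x : (w.adicCompletion E)ˣ, Valued.v (x : w.adicCompletion E) = 1 → ν x = 1) ∧
      (∀ x, ν x ^ N = 1) ∧
      ∀ x : (w.adicCompletion E)ˣ, Valued.v (x : w.adicCompletion E) = WithZero.exp (-1 : ℤ) → ν x ≠ 1 := by
  have hN0 : N ≠ 0 := by omega
  have hprim : IsPrimitiveRoot (Complex.exp (2 * Real.pi * Complex.I / (N : ℕ))) N := Complex.isPrimitiveRoot_exp N hN0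
  set ζ : ℂˣ := (hprim.isUnit hN0).unit with hζdef
  have hζval : (ζ : ℂ) = Complex.exp (2 * Real.pi * Complex.I / (N : ℕ)) := (hprim.isUnit hN0).unit_spec
  have hζ : IsPrimitiveRoot ζ N := IsPrimitiveRoot.coe_units_iff.1 (by rw [hζval]; exact hprim)
  have hζN : ζ ^ N = 1 := hζ.pow_eq_one
  have hζne : ζ ≠ 1 := hζ.ne_one (by omega)
  have hζnorm : ‖(ζ : ℂ)‖ = 1 := by rw [hζval]; exact hprim.norm'_eq_one hN0
  set f : Multiplicative ℤ →* ℂ := (Units.coeHom ℂ).comp (zpowersHom ℂˣ ζ) with hfdef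
  set ν₀ : w.adicCompletion E →*₀ ℂ :=
    (WithZero.lift' f).comp (Valued.v : Valuation (w.adicCompletion E) (WithZero (Multiplicative ℤ))).toMonoidWithZeroHom
    with hν₀def
  have hν₀ : ∀ x : w.adicCompletion E, x ≠ 0 → ν₀ x = ((ζ ^ WithZero.log (Valued.v x) : ℂˣ) : ℂ) := by
    intro x hx
    have hvx : Valued.v x ≠ 0 := (Valuation.ne_zero_iff _).2 hx
    rw [hν₀def, MonoidWithZeroHom.comp_apply]
    change WithZero.lift' f (Valued.v x) = _
    conv_lhs => rw [← WithZero.exp_log hvx]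
    rw [show WithZero.exp (WithZero.log (Valued.v x)) =
        ((Multiplicative.ofAdd (WithZero.log (Valued.v x)) : Multiplicative ℤ) : WithZero (Multiplicative ℤ)) from rfl,
      WithZero.lift'_coe, hfdef, MonoidHom.comp_apply, zpowersHom_apply, Units.coeHom_apply]
    rfl
  set ν : (w.adicCompletion E)ˣ →* ℂˣ := Units.map ν₀.toMonoidHom with hνdef
  have hν : ∀ x : (w.adicCompletion E)ˣ, ν x = ζ ^ WithZero.log (Valued.v (x : w.adicCompletion E)) := by
    intro x
    apply Units.ext
    rw [hνdef, Units.coe_map]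
    exact hν₀ x x.ne_zero
  refine ⟨ν, fun x => ?_, fun x hx => ?_, fun x => ?_, fun x hx => ?_⟩
  · rw [hν, Units.val_zpow_eq_zpow_val, norm_zpow, hζnorm, one_zpow]
  · rw [hν, hx, WithZero.log_one, zpow_zero]
  · rw [hν, ← zpow_natCast, ← zpow_mul, mul_comm, zpow_mul, zpow_natCast, hζN, one_zpow]
  · rw [hν, hx, WithZero.log_exp, zpow_neg, zpow_one, Ne, inv_eq_one]
    exact hζne

omit [Algebra F E] [Algebra.IsQuadraticExtension F E] in
/-- `{y : v_w(y) = 1}` is open in `E_w` (the valuation is locally constant off `0`). [folklore] -/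
private theorem isOpen_setOf_valued_eq_one (w : HeightOneSpectrum (𝓞 E)) :
    IsOpen {y : w.adicCompletion E | Valued.v y = 1} := by
  refine isOpen_iff_mem_nhds.2 fun y hy => ?_
  rw [Set.mem_setOf_eq] at hy
  have h := Valued.locally_const (x := y) (by rw [hy]; exact one_ne_zero)
  simpa only [hy] using h

include hcδ hδ in
/-- **the DET CARRIER character at a SPLIT place** (`c • w ≠ w`, ANY `N ≥ 2`): the character `Ψ(g) = ν_w(det(g)_w) = ζ_N^{ord_w det(g)_w}` of
`U(V)(F_v) = S.U` is TRIVIAL ON THE CENTRE (`det(z · 1_N) = z^N` and `ν_w^N = 1`: `Ψ ∘ S.scalar = 1`), trivial on the open neighbourhood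
`{g : v_w(det(g)_w) = 1}` of `1`, has all its values `N`-th roots of unity of modulus `1`, and is NOT trivial: `Ψ(g₀) = ζ_N^{−1} ≠ 1` at an
element `g₀ ∈ U(V)(F_v)` with `det g₀ = ι(a)`, `a · c(a) = 1`, `v_w(a) = exp(−1)` (§2 and `exists_mul_conj_eq_one_valuation_eq_of_split`).  So at a
split place `U(V)(F_v)` carries two characters — `1` and `Ψ` — with the SAME restriction to the centre `E_v¹`.
[cite: Liu2021, App. D §D.1 Step 3 (l. 5221)] [cite: Mok2014, §1 Notation p. 5] -/
theorem exists_det_carrier_character_of_split (w : PlacesOver E v) (hw : c • w.1 ≠ w.1) :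
    ∃ Ψ : (LemD1OfPlace.standingData E v c N J hcδ hδ hN hJh hJdet).U →* ℂˣ,
      (∀ z : (LemD1OfPlace.standingData E v c N J hcδ hδ hN hJh hJdet).normOne,
        Ψ ((LemD1OfPlace.standingData E v c N J hcδ hδ hN hJh hJdet).scalar z) = 1) ∧
      (∃ O : Set (LemD1OfPlace.standingData E v c N J hcδ hδ hN hJh hJdet).U, IsOpen O ∧ 1 ∈ O ∧ ∀ g ∈ O, Ψ g = 1) ∧
      (∃ g₀ : (LemD1OfPlace.standingData E v c N J hcδ hδ hN hJh hJdet).U, Ψ g₀ ≠ 1) ∧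
      (∀ g, Ψ g ^ N = 1) ∧ (∀ g, ‖((Ψ g : ℂˣ) : ℂ)‖ = 1) := by
  obtain ⟨ν, hνnorm, hν1, hνN, hνϖ⟩ := exists_unramified_character E w.1 hN
  let prw : (LocalRing E v)ˣ →* (w.1.adicCompletion E)ˣ :=
    Units.map (Pi.evalRingHom (fun w' : PlacesOver E v => w'.1.adicCompletion E) w).toMonoidHom
  have hprw : ∀ y : (LocalRing E v)ˣ, ((prw y : (w.1.adicCompletion E)ˣ) : w.1.adicCompletion E) = (y : LocalRing E v) w :=
    fun y => rfl
  let detU : (LemD1OfPlace.standingData E v c N J hcδ hδ hN hJh hJdet).U →* (LocalRing E v)ˣ :=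
    Matrix.GeneralLinearGroup.det.comp (LemD1OfPlace.standingData E v c N J hcδ hδ hN hJh hJdet).U.subtype
  let Ψ : (LemD1OfPlace.standingData E v c N J hcδ hδ hN hJh hJdet).U →* ℂˣ := ν.comp (prw.comp detU)
  have hΨ : ∀ g, Ψ g = ν (prw (Matrix.GeneralLinearGroup.det (g : GL (Fin N) (LocalRing E v)))) := fun g => rfl
  -- det of a scalar
  have hdet : ∀ z : (LemD1OfPlace.standingData E v c N J hcδ hδ hN hJh hJdet).normOne,
      Matrix.GeneralLinearGroup.det (((LemD1OfPlace.standingData E v c N J hcδ hδ hN hJh hJdet).scalar z :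
        (LemD1OfPlace.standingData E v c N J hcδ hδ hN hJh hJdet).U) : GL (Fin N) (LocalRing E v)) =
      (z : (LocalRing E v)ˣ) ^ N := fun z => by
    apply Units.ext
    rw [Matrix.GeneralLinearGroup.val_det_apply, OscillatorStandingData.coe_scalar, Matrix.scalar_apply, Matrix.det_diagonal,
      Finset.prod_const, Finset.card_univ, Fintype.card_fin, Units.val_pow_eq_pow_val]
  refine ⟨Ψ, fun z => ?_, ?_, ?_, fun g => by rw [hΨ, hνN], fun g => by rw [hΨ, hνnorm]⟩
  · rw [hΨ, hdet, map_pow, map_pow, hνN]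
  · -- the open neighbourhood `{g : v_w(det(g)_w) = 1}`
    let f : (LemD1OfPlace.standingData E v c N J hcδ hδ hN hJh hJdet).U → w.1.adicCompletion E := fun g =>
      (((g : GL (Fin N) (LocalRing E v)) : Matrix (Fin N) (Fin N) (LocalRing E v)).map
        (Pi.evalRingHom (fun w' : PlacesOver E v => w'.1.adicCompletion E) w)).det
    have hf : ∀ g, f g = ((prw (Matrix.GeneralLinearGroup.det (g : GL (Fin N) (LocalRing E v))) :
        (w.1.adicCompletion E)ˣ) : w.1.adicCompletion E) := fun g => by
      rw [hprw, Matrix.GeneralLinearGroup.val_det_apply]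
      change _ = (Pi.evalRingHom (fun w' : PlacesOver E v => w'.1.adicCompletion E) w)
        (((g : GL (Fin N) (LocalRing E v)) : Matrix (Fin N) (Fin N) (LocalRing E v)).det)
      rw [RingHom.map_det]
      rfl
    have hfc : Continuous f := by
      refine Continuous.matrix_det ?_
      refine Continuous.matrix_map ?_ (continuous_apply w)
      exact Units.continuous_val.comp continuous_subtype_val
    refine ⟨f ⁻¹' {y | Valued.v y = 1}, (isOpen_setOf_valued_eq_one E w.1).preimage hfc, ?_, fun g hg => ?_⟩
    · rw [Set.mem_preimage, Set.mem_setOf_eq, hf, OneMemClass.coe_one, map_one, map_one, Units.val_one, map_one]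
    · rw [Set.mem_preimage, Set.mem_setOf_eq, hf] at hg
      rw [hΨ]
      exact hν1 _ hg
  · -- non-triviality at the dilation of ratio `ι(a)`, `v_w(a) = exp(−1)`
    obtain ⟨a, ha, haw⟩ := exists_mul_conj_eq_one_valuation_eq_of_split E v c hcδ hδ w hw
    obtain ⟨g₀, hg₀⟩ := exists_mem_U_det_eq_algebraMap E v c hcδ hδ N J hN hJh hJdet a ha
    refine ⟨g₀, ?_⟩
    rw [hΨ]
    refine hνϖ _ ?_
    rw [hprw, hg₀]
    change Valued.v ((a : E) : w.1.adicCompletion E) = _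
    rw [HeightOneSpectrum.valuedAdicCompletion_eq_valuation', haw]

/-! ## §4 The JOINT certificate «(1) ∧ (3)» in which the `μ`-conjunct ALONE separates — every SPLIT place, every `N ≥ 3` -/

/-- For a datum whose carrier is the line `ℂ` with `U(V)(F)` acting through a character `λ` that agrees with `χ` on the centre,
the `χ`-augmentation submodule vanishes (copy of the siblings' private lemma). [folklore] -/
private theorem augmentation_eq_bot_of_character {F₀ E₀ : Type} [Field F₀] [ValuativeRel F₀] [TopologicalSpace F₀]
    [CommRing E₀] [Algebra F₀ E₀] [TopologicalSpace E₀] {n : ℕ} (L : LemD1Data F₀ E₀ n ℂ) (lam : L.S.U →* ℂˣ)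
    (hω : ∀ (g : L.S.U) (x : ℂ), L.omega g x = (lam g : ℂ) * x)
    (hcen : ∀ z : L.S.normOne, lam (L.S.scalar z) = L.chi z) :
    augmentation L.omega L.S.scalar L.chi = ⊥ := by
  unfold augmentation
  refine iSup_eq_bot.2 fun z => ?_
  rw [LinearMap.range_eq_bot]
  ext
  simp [hω, hcen]

/-- Two lines on which a group acts through characters `λ₁` and `λ₀` with `λ₁ g₀ ≠ λ₀ g₀` for some `g₀` have NON-isomorphic maximal
`χ`-quotients (the first quotient being the line itself).  Copy of the siblings' private lemma. [folklore] -/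
private theorem not_areIsomorphicRep_quotRep_of_characters {G Z : Type*} [Group G] [Group Z]
    (ρ₁ ρ₀ : Representation ℂ G ℂ) {ζ : Z →* G} (hζ : ∀ z, ζ z ∈ Subgroup.center G) (χ₁ χ₀ : Z →* ℂˣ)
    (lam₁ lam₀ : G →* ℂˣ) (h₁ : ∀ (g : G) (x : ℂ), ρ₁ g x = (lam₁ g : ℂ) * x) (h₀ : ∀ (g : G) (x : ℂ), ρ₀ g x = (lam₀ g : ℂ) * x)
    (hN₁ : augmentation ρ₁ ζ χ₁ = ⊥) {g₀ : G} (hg₀ : lam₁ g₀ ≠ lam₀ g₀) :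
    ¬ AreIsomorphicRep (quotRep ρ₁ hζ χ₁) (quotRep ρ₀ hζ χ₀) := by
  rintro ⟨f, hf⟩
  have hw0 : (Submodule.Quotient.mk 1 : ℂ ⧸ augmentation ρ₁ ζ χ₁) ≠ 0 := by
    rw [Ne, Submodule.Quotient.mk_eq_zero, hN₁, Submodule.mem_bot]
    exact one_ne_zero
  have h1 : quotRep ρ₁ hζ χ₁ g₀ (Submodule.Quotient.mk 1) =
      (lam₁ g₀ : ℂ) • (Submodule.Quotient.mk 1 : ℂ ⧸ augmentation ρ₁ ζ χ₁) := by
    rw [quotRep_mk, h₁, ← smul_eq_mul, Submodule.Quotient.mk_smul]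
  have h2 : ∀ y : ℂ ⧸ augmentation ρ₀ ζ χ₀, quotRep ρ₀ hζ χ₀ g₀ y = (lam₀ g₀ : ℂ) • y := by
    intro y
    obtain ⟨u, rfl⟩ := Submodule.Quotient.mk_surjective _ y
    rw [quotRep_mk, h₀, ← smul_eq_mul, Submodule.Quotient.mk_smul]
  have key := hf g₀ (Submodule.Quotient.mk 1)
  rw [h1, h2, map_smul] at key
  have hsub : ((lam₁ g₀ : ℂ) - lam₀ g₀) • f (Submodule.Quotient.mk 1) = 0 := by
    rw [sub_smul, key, sub_self]
  rcases smul_eq_zero.1 hsub with h | h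
  · exact hg₀ (Units.ext (sub_eq_zero.1 h))
  · exact hw0 (f.injective (by rw [h, map_zero]))

/-- **Item (1) AS PRINTED holds at a character datum of rank `n ≠ 2`** (copy of the siblings' private lemma).
[cite: Liu2021, App. D Lemma D.1 (1) (l. 5229)] -/
private theorem lemD1_1AsPrinted_of_character_of_rank_ne_two' {F₀ E₀ : Type} [Field F₀] [ValuativeRel F₀]
    [TopologicalSpace F₀] [CommRing E₀] [Algebra F₀ E₀] [TopologicalSpace E₀] [IsTopologicalRing E₀] {n₀ : ℕ}
    (L : LemD1Data F₀ E₀ n₀ ℂ) (lam : L.S.U →* ℂˣ) (hω : ∀ (g : L.S.U) (x : ℂ), L.omega g x = (lam g : ℂ) * x)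
    (hcen : ∀ z : L.S.normOne, lam (L.S.scalar z) = L.chi z)
    (hopen : ∃ O : Set L.S.U, IsOpen O ∧ (1 : L.S.U) ∈ O ∧ ∀ g ∈ O, lam g = 1) (hn : n₀ ≠ 2) :
    LemD1_1AsPrinted L := by
  have hN : augmentation L.omega L.S.scalar L.chi = ⊥ := augmentation_eq_bot_of_character L lam hω hcen
  have hfin : Module.finrank ℂ (ℂ ⧸ augmentation L.omega L.S.scalar L.chi) = 1 := by
    rw [(Submodule.quotEquivOfEqBot _ hN).finrank_eq, Module.finrank_self]
  haveI hsimple : IsSimpleModule ℂ (ℂ ⧸ augmentation L.omega L.S.scalar L.chi) :=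
    isSimpleModule_iff_finrank_eq_one.2 hfin
  have hact : ∀ (g : L.S.U) (w : ℂ ⧸ augmentation L.omega L.S.scalar L.chi),
      L.datum.quot g w = (lam g : ℂ) • w := by
    intro g w
    obtain ⟨y, rfl⟩ := Submodule.Quotient.mk_surjective _ w
    rw [LemD1Data.datum_quot, quotRep_mk, hω, ← smul_eq_mul, Submodule.Quotient.mk_smul]
  refine ⟨⟨?_, ?_, ?_⟩, ?_⟩
  · intro W
    rcases eq_bot_or_eq_top W.toSubmodule with h | h
    · exact Or.inl (Subrepresentation.toSubmodule_injective h)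
    · exact Or.inr (Subrepresentation.toSubmodule_injective h)
  · intro x
    obtain ⟨O, hO, h1O, hlam⟩ := hopen
    change IsOpen (L.datum.quot.stabilizerSubgroup x : Set L.S.U)
    refine Subgroup.isOpen_of_mem_nhds _ (g := 1) (Filter.mem_of_superset (hO.mem_nhds h1O) fun g hg => ?_)
    change L.datum.quot g x = x
    rw [hact, hlam g hg, Units.val_one, one_smul]
  · intro K _
    infer_instance
  · refine iff_of_false ?_ ?_
    · rw [not_subsingleton_iff_nontrivial]
      exact Module.nontrivial_of_finrank_pos (R := ℂ) (by rw [hfin]; exact one_pos)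
    · exact fun h => hn h.2.1.2

include hcδ in
/-- **(1) ∧ (3) JOINTLY with the `μ`-CONJUNCT ALONE SEPARATING — every SPLIT place, every `N ≥ 3`**: for every element `μ` of the printed
Step-2 index set and every representative `e`, the two-member collection with labels `(μ, e, 1)` and `(μ', e, 1)` — `μ'` the level twist
(`μ'(ε) = −μ(ε)`, `…LevelTwist.exists_muSet_ne_twist`), the SAME `ε`, the SAME (trivial) Step-3 character `χ = 1` — and carriers the trivial line and
the line of the det carrier `Ψ` of §3 (both with central character `1`) satisfies [Lem. D.1, first sentence + (1)] AS PRINTED member by member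
AND [Lem. D.1 (3)] AS PRINTED for all four pairs: the two `ω`'s are NON-isomorphic (`Ψ(g₀) ≠ 1`) although their central characters COINCIDE, and
of the three conjuncts «`μ' = μ`, `ε' = ε`, `χ' = χ`» exactly the FIRST fails.  (`…LevelCarrier` §4 separated by `μ` AND `χ` together, or by `χ`
alone; the «What this does NOT give» there opens with this model.) [cite: Liu2021, App. D Lemma D.1 (1) and (3) (l. 5229, 5233)] -/
theorem exists_lemD1IndexedFamily_item1_and_lemD1_3_mu_of_split (w : PlacesOver E v) (hw : c • w.1 ≠ w.1) (h3 : 3 ≤ N)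
    (μ : LemD1.MuSet (LemD1OfPlace.standingData E v c N J hcδ hδ hN hJh hJdet))
    (e : LemD1.EpsRep (LemD1OfPlace.standingData E v c N J hcδ hδ hN hJh hJdet)) :
    ∃ Lf : LemD1IndexedFamily (v.adicCompletion F) (LocalRing E v) N (Fin 2),
      Lf.S = LemD1OfPlace.standingData E v c N J hcδ hδ hN hJh hJdet ∧
      (∀ i, (Lf.eps i).1 = e.1) ∧ (∀ i, (Lf.chi i).1 = 1) ∧ (Lf.mu 0).1 = μ.1 ∧
      (Lf.mu 1).1 (LemD1OfPlace.eps E v hδ) = -μ.1 (LemD1OfPlace.eps E v hδ) ∧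
      Lf.Item1AsPrinted ∧ LemD1_3AsPrintedI Lf ∧
      Lf.mu 0 ≠ Lf.mu 1 ∧ LemD1.SameClass (Lf.eps 0) (Lf.eps 1) ∧ Lf.chi 0 = Lf.chi 1 ∧
      ¬ AreIsomorphicRep (Lf.quot 1) (Lf.quot 0) := by
  classical
  obtain ⟨e₁, he₁⟩ := e
  have hN2 : N ≠ 2 := by omega
  obtain ⟨μ₁, hne, hμ₁, -⟩ := LemD1IndexedNonVacuityLevelTwist.exists_muSet_ne_twist E v c hcδ hδ N J hN hJh hJdet w μ
  obtain ⟨Ψ, hcen, hopen, ⟨g₀, hΨg₀⟩, -, -⟩ := exists_det_carrier_character_of_split E v c hcδ hδ N J hN hJh hJdet w hw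
  let S := LemD1OfPlace.standingData E v c N J hcδ hδ hN hJh hJdet
  let χ₀ : LemD1.ChiSet S := ⟨1, fun z => by simp, by simpa using continuous_const⟩
  let ω₀ : Representation ℂ S.U ℂ := Representation.trivial ℂ S.U ℂ
  let ω₁ : Representation ℂ S.U ℂ := (DistribMulAction.toModuleEnd ℂ ℂ).comp Ψ
  have hω₀ : ∀ (g : S.U) (x : ℂ), ω₀ g x = ((1 : S.U →* ℂˣ) g : ℂ) * x := fun g x => by
    rw [MonoidHom.one_apply, Units.val_one, one_mul]; rfl
  have hω₁ : ∀ (g : S.U) (x : ℂ), ω₁ g x = (Ψ g : ℂ) * x := fun g x => by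
    change (Ψ g : ℂˣ) • x = _
    rw [Units.smul_def, smul_eq_mul]
  have hcen' : ∀ z : S.normOne, Ψ (S.scalar z) = χ₀.1 z := fun z => by
    rw [hcen z]; rfl
  let Lf : LemD1IndexedFamily (v.adicCompletion F) (LocalRing E v) N (Fin 2) :=
    { isNonarchimedeanLocalField := inferInstance
      isModuleTopology := LemD1OfPlace.isModuleTopology_localRing E v
      S := S
      mu := ![μ, μ₁]
      eps := fun _ => ⟨e₁, he₁⟩
      chi := fun _ => χ₀
      V := fun _ => ℂ
      omega := ![ω₀, ω₁] }
  have hμne : Lf.mu 0 ≠ Lf.mu 1 := fun h => hne h.symm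
  -- non-isomorphism: `Ψ(g₀) ≠ 1`
  have hN₁ : augmentation (Lf.single 1).omega (Lf.single 1).S.scalar (Lf.single 1).chi = ⊥ :=
    augmentation_eq_bot_of_character (Lf.single 1) Ψ hω₁ hcen'
  have hg₀ : Ψ g₀ ≠ (1 : S.U →* ℂˣ) g₀ := by rwa [MonoidHom.one_apply]
  have hnotiso : ¬ AreIsomorphicRep (Lf.quot 1) (Lf.quot 0) :=
    not_areIsomorphicRep_quotRep_of_characters ω₁ ω₀ S.scalar_mem_center χ₀.1 χ₀.1 Ψ 1 hω₁ hω₀ hN₁ hg₀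
  -- (1) member by member
  have hItem1 : Lf.Item1AsPrinted := by
    intro i
    fin_cases i
    · exact lemD1_1AsPrinted_of_character_of_rank_ne_two' (Lf.single 0) 1 hω₀ (fun z => rfl)
        ⟨Set.univ, isOpen_univ, Set.mem_univ _, fun g _ => rfl⟩ hN2
    · exact lemD1_1AsPrinted_of_character_of_rank_ne_two' (Lf.single 1) Ψ hω₁ hcen' hopen hN2
  -- (3) for all four pairs
  have hrefl : ∀ k : Fin 2, (AreIsomorphicRep (Lf.quot k) (Lf.quot k) ↔
      (Lf.mu k = Lf.mu k ∧ LemD1.SameClass (Lf.eps k) (Lf.eps k) ∧ Lf.chi k = Lf.chi k)) :=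
    fun k => iff_of_true ⟨LinearEquiv.refl ℂ _, fun _ _ => rfl⟩ ⟨rfl, ⟨1, by simp⟩, rfl⟩
  have hItem3 : LemD1_3AsPrintedI Lf := by
    intro _ i j
    fin_cases i <;> fin_cases j
    · exact hrefl 0
    · exact iff_of_false hnotiso fun h => hμne h.1.symm
    · exact iff_of_false (fun h => hnotiso h.symm) fun h => hμne h.1
    · exact hrefl 1
  have hsame : LemD1.SameClass (Lf.eps 0) (Lf.eps 1) := hrefl 0 |>.mp ⟨LinearEquiv.refl ℂ _, fun _ _ => rfl⟩ |>.2.1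
  exact ⟨Lf, rfl, fun _ => rfl, fun _ => rfl, rfl, hμ₁, hItem1, hItem3, hμne, hsame, rfl, hnotiso⟩

include hcδ in
/-- **Consequence — every SPLIT place, every `N ≥ 3`, HYPOTHESIS-FREE**: the two displayed records (1) ∧ (3) read on an indexed collection
over the place model do NOT by their shape force «members with the same `ε`-class and the same Step-3 character `χ` carry the same Step-2
character `μ`»: in [Lem. D.1 (3)] the `μ`-conjunct is independent of the other two (the Step-2 index set is non-empty at a split place —
the trivial character, `…AtPlace.one_mem_muSet_of_split`). [cite: Liu2021, App. D Lemma D.1 (1) and (3) (l. 5229, 5233)] -/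
theorem not_forall_mu_eq_of_sameClass_of_chi_eq_of_split (w : PlacesOver E v) (hw : c • w.1 ≠ w.1) (h3 : 3 ≤ N) :
    ¬ ∀ Lf : LemD1IndexedFamily (v.adicCompletion F) (LocalRing E v) N (Fin 2),
        Lf.S = LemD1OfPlace.standingData E v c N J hcδ hδ hN hJh hJdet →
        Lf.Item1AsPrinted → LemD1_3AsPrintedI Lf →
        ∀ i j : Fin 2, LemD1.SameClass (Lf.eps i) (Lf.eps j) → Lf.chi i = Lf.chi j → Lf.mu i = Lf.mu j := by
  obtain ⟨h1n, h1c, h1F⟩ := LemD1IndexedNonVacuityAtPlace.one_mem_muSet_of_split E v c w hw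
  intro h
  obtain ⟨Lf, hS, -, -, -, -, h1, h3', hne, hsame, hchi, -⟩ :=
    exists_lemD1IndexedFamily_item1_and_lemD1_3_mu_of_split E v c hcδ hδ N J hN hJh hJdet w hw h3
      (LemD1OfPlace.muOf E v c N J hcδ hδ hN hJh hJdet 1 h1n h1c h1F) (LemD1OfPlace.epsDelta E v c N J hcδ hδ hN hJh hJdet)
  exact hne (h Lf hS h1 h3' 0 1 hsame hchi)

include hcδ in
/-- **… nor «members with the same Step-3 character `χ` (the central character of `ω(μ, ε, χ)`) have isomorphic `ω`'s»** — every SPLIT place,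
every `N ≥ 3`, hypothesis-free: (3) AS PRINTED distinguishes carriers that the centre does not. [cite: Liu2021, App. D Lemma D.1 (1) and (3) (l. 5229, 5233)] -/
theorem not_forall_areIsomorphicRep_of_chi_eq_of_split (w : PlacesOver E v) (hw : c • w.1 ≠ w.1) (h3 : 3 ≤ N) :
    ¬ ∀ Lf : LemD1IndexedFamily (v.adicCompletion F) (LocalRing E v) N (Fin 2),
        Lf.S = LemD1OfPlace.standingData E v c N J hcδ hδ hN hJh hJdet →
        Lf.Item1AsPrinted → LemD1_3AsPrintedI Lf →
        ∀ i j : Fin 2, Lf.chi i = Lf.chi j → AreIsomorphicRep (Lf.quot j) (Lf.quot i) := by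
  obtain ⟨h1n, h1c, h1F⟩ := LemD1IndexedNonVacuityAtPlace.one_mem_muSet_of_split E v c w hw
  intro h
  obtain ⟨Lf, hS, -, -, -, -, h1, h3', -, -, hchi, hnot⟩ :=
    exists_lemD1IndexedFamily_item1_and_lemD1_3_mu_of_split E v c hcδ hδ N J hN hJh hJdet w hw h3
      (LemD1OfPlace.muOf E v c N J hcδ hδ hN hJh hJdet 1 h1n h1c h1F) (LemD1OfPlace.epsDelta E v c N J hcδ hδ hN hJh hJdet)
  exact hnot (h Lf hS h1 h3' 0 1 hchi)

end PlaceModel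

/-! ## §5 The CM rows at a SPLIT place of `L/L⁺`: the rows' OWN `μ_v` as member `0` -/

section CM

open Literature.NumberTheory.GelbartRogawski1991.UnitaryDualPair (imagUnit complexConj_imagUnit imagUnit_ne_zero)
open Literature.NumberTheory.GelbartRogawski1991.UnitaryDualPair.LocalSplitting (localMu norm_localMu continuous_localMu
  localMu_toLocalRing_eq_one_iff)
open Literature.NumberTheory.Automorphic.IdeleClassGroup (toHeckeCharacter isUnitary_toHeckeCharacter IsConjugateSymplectic)
open Literature.RepresentationTheory.Liu2021 (isOscillatorChar_toHeckeCharacter_iff)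

variable (L : Type) [Field L] [NumberField L] [IsCMField L]

local notation3 "cc" => (IsCMField.complexConj L)
local notation3 "L⁺" => (↥(maximalRealSubfield L))

variable (v : HeightOneSpectrum (𝓞 (maximalRealSubfield L))) (N : ℕ) (J : Matrix (Fin N) (Fin N) L) (hN : 2 ≤ N)
  (hJh : (J.map (IsCMField.complexConj L))ᵀ = J) (hJdet : J.det ≠ 0)

/-- **the `μ`-alone certificate with the rows' OWN `μ_v` as member `0` — every SPLIT place `v` of `L⁺` (`cc • w ≠ w` for some `w ∣ v`),
every `N ≥ 3`, every conjugate symplectic `ψ`**: labels `(μ_v, ε, 1)`, `(μ', ε, 1)` with `μ_v = localMu L (toHeckeCharacter L ψ) v` packaged by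
`LemD1OfPlace.muOf` with VERBATIM the displayed proofs and `μ'(ε) = −μ_v(ε)`; carriers the trivial line and the det carrier line (same central
character); (1) member by member AND (3) for all four pairs; only the `μ`-slots differ; the `ω`'s non-isomorphic.
[cite: Liu2021, App. D Lemma D.1 (1) and (3) (l. 5229, 5233); Def. 4.11 (l. 2086)] -/
theorem exists_lemD1IndexedFamily_item1_and_lemD1_3_localMu_mu_of_split (w : PlacesOver L v) (hw : cc • w.1 ≠ w.1) (h3 : 3 ≤ N)
    (ψ : IdeleClassGroup L →ₜ* Circle) (hψ : IsConjugateSymplectic L ψ) :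
    ∃ Lf : LemD1IndexedFamily (v.adicCompletion L⁺) (LocalRing L v) N (Fin 2),
      Lf.S = LemD1OfPlace.standingData L v cc N J (complexConj_imagUnit L) (imagUnit_ne_zero L) hN hJh hJdet ∧
      (∀ i, (Lf.eps i).1 = LemD1OfPlace.eps L v (imagUnit_ne_zero L)) ∧ (∀ i, (Lf.chi i).1 = 1) ∧
      (Lf.mu 0).1 = localMu L (toHeckeCharacter L ψ) v ∧
      (Lf.mu 1).1 (LemD1OfPlace.eps L v (imagUnit_ne_zero L)) =
        -localMu L (toHeckeCharacter L ψ) v (LemD1OfPlace.eps L v (imagUnit_ne_zero L)) ∧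
      Lf.Item1AsPrinted ∧ LemD1_3AsPrintedI Lf ∧
      Lf.mu 0 ≠ Lf.mu 1 ∧ LemD1.SameClass (Lf.eps 0) (Lf.eps 1) ∧ Lf.chi 0 = Lf.chi 1 ∧
      ¬ AreIsomorphicRep (Lf.quot 1) (Lf.quot 0) :=
  exists_lemD1IndexedFamily_item1_and_lemD1_3_mu_of_split L v cc (complexConj_imagUnit L) (imagUnit_ne_zero L) N J hN hJh hJdet
    w hw h3
    (LemD1OfPlace.muOf L v cc N J (complexConj_imagUnit L) (imagUnit_ne_zero L) hN hJh hJdet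
      (localMu L (toHeckeCharacter L ψ) v)
      (fun x => norm_localMu L (toHeckeCharacter L ψ) v (isUnitary_toHeckeCharacter L ψ) x)
      (continuous_localMu L (toHeckeCharacter L ψ) v)
      (fun t => localMu_toLocalRing_eq_one_iff L (toHeckeCharacter L ψ) v
        ((isOscillatorChar_toHeckeCharacter_iff ψ).mpr hψ) t))
    (LemD1OfPlace.epsDelta L v cc N J (complexConj_imagUnit L) (imagUnit_ne_zero L) hN hJh hJdet)

/-- **the records `hD1''` ∕ `hD3` read at the rows' slot types do not force «same `ε`-class and same `χ` ⟹ same `μ`» — at every SPLIT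
place `v` of `L⁺`, for every `N ≥ 3`** (the END's rank is `3`). [cite: Liu2021, App. D Lemma D.1 (1) and (3) (l. 5229, 5233)] -/
theorem not_forall_mu_eq_of_sameClass_of_chi_eq_of_isCMField_of_split (w : PlacesOver L v) (hw : cc • w.1 ≠ w.1) (h3 : 3 ≤ N) :
    ¬ ∀ Lf : LemD1IndexedFamily (v.adicCompletion L⁺) (LocalRing L v) N (Fin 2),
        Lf.S = LemD1OfPlace.standingData L v cc N J (complexConj_imagUnit L) (imagUnit_ne_zero L) hN hJh hJdet →
        Lf.Item1AsPrinted → LemD1_3AsPrintedI Lf →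
        ∀ i j : Fin 2, LemD1.SameClass (Lf.eps i) (Lf.eps j) → Lf.chi i = Lf.chi j → Lf.mu i = Lf.mu j :=
  not_forall_mu_eq_of_sameClass_of_chi_eq_of_split L v cc (complexConj_imagUnit L) (imagUnit_ne_zero L) N J hN hJh hJdet w hw h3

/-- **… nor «same central character ⟹ isomorphic carriers»** at every SPLIT place of `L⁺`, every `N ≥ 3`.
[cite: Liu2021, App. D Lemma D.1 (1) and (3) (l. 5229, 5233)] -/
theorem not_forall_areIsomorphicRep_of_chi_eq_of_isCMField_of_split (w : PlacesOver L v) (hw : cc • w.1 ≠ w.1) (h3 : 3 ≤ N) :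
    ¬ ∀ Lf : LemD1IndexedFamily (v.adicCompletion L⁺) (LocalRing L v) N (Fin 2),
        Lf.S = LemD1OfPlace.standingData L v cc N J (complexConj_imagUnit L) (imagUnit_ne_zero L) hN hJh hJdet →
        Lf.Item1AsPrinted → LemD1_3AsPrintedI Lf →
        ∀ i j : Fin 2, Lf.chi i = Lf.chi j → AreIsomorphicRep (Lf.quot j) (Lf.quot i) :=
  not_forall_areIsomorphicRep_of_chi_eq_of_split L v cc (complexConj_imagUnit L) (imagUnit_ne_zero L) N J hN hJh hJdet w hw h3

end CM

end Literature.NumberTheory.Automorphic.Liu2021.LemD1IndexedNonVacuityDetCarrier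

end
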